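import Mathlib
import HarnessLib
import Summits.HubbardSuperconductivity.HubbardSuperconductivity.Theorems.KLProgrammeCountPairsOffset

/-!
# Route `KLProgramme`, crux K3 `KLRegimeTwoPointLimit` — the arbitrary-offset pair count at ANISOTROPIC tolerance is `O(1/w)`:
# the Cooper and forward logarithms of Lemma F.1 are ADDITIVE when the energy shell is `C_δ w²` instead of `C_δ w`
# (cell gate-hubbard-kl, seat p1 = C1 `BetaSplit` lead, generation 4; HOME/p1/E5A-NOTE.md §2, item `CountPairsAniso`)

Lemma F.1 of the cell's DECOMP (App. F; PROVED by seat p4 as `CountPairsOffset.count_pairs_offset_exists`, route item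
`CountPairsOffset`) counts the grid pairs `(θ₂, θ₃)` of mesh `w` with `|ε(P + p(θ₂) + p(θ₃)) − μ| ≤ C_δ·w` by
`K_p (J + 2 + log N)/w` — the one-fixed-leg four-sector count of Benfatto–Giuliani–Mastropietro's ISOTROPIC sectors
(length = thickness = `w`; BGM 2006 Lemma 3.1 (3.23), `cγ^{-h}|h|`).  For BGM's ANISOTROPIC sectors (length `γ^{h/2}`,
thickness `γ^{h}`; (2.45)–(2.48)) the relevant tolerance is `C_δ·w²` at angular mesh `w`, and the count is `O(1/w)` with NO
logarithm — BGM (2.96)/Lemma A3.1 at `L = 4` in `ℝ²`; here modulo `2πℤ²` (the level function `hfunP` is `2π`-periodic) and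
uniformly in the offset `P`.  This is the counting input that makes the improved-norm weight of the quartic kernel,
`𝔩_h ‖λ̃_h‖_{1,O_h}`, of order `U` UNIFORMLY in the scale (E5A-NOTE §0.4: a multiplicative `|h|` would break FKTr2's
smallness hypothesis at the Kohn–Luttinger scales `|h| ≈ c/U²`).

The proof is p4's fibration scheme verbatim with the tolerance `δ = C_δ w²` carried through its `δ`-generic pieces:
the transversal families stay `O(N)`; the Cooper range (`count_odd_total_offset`) gives `N + 2C₅((4C_δ/h_min)(1 + log N) + N)`
— the harmonic logarithm now multiplies `w⁰`; the forward (even) range (`count_anti_totalP`, applied with `C_δ ↦ C_δ w`)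
gives `(J+1)·K_dy(C_δ w)/w` with `K_dy(C_δ w) ≤ √w · K_dy(C_δ)` (`forwardFold_const_scale`: every term of the fold constant carries
a power `≥ ½` of the tolerance) and `(J + 1)√w ≤ 7` (`dyadic_level_mul_sqrt_le`).

* `dyadic_level_mul_sqrt_le` — `2^J w = π`, `0 < w ≤ 1` ⇒ `(J + 1)√w ≤ 7`;
* `forwardFold_const_scale` — the fold constant scales like `√w`;
* `count_pairs_aniso_exists` — **Lemma F.1 at anisotropic tolerance**: `#{(a,c) : |h_P(θ_a, θ_c)| ≤ C_δ w²} ≤ K_p / w`,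
  uniformly in the level `μ` (margin `η₀`), the offset `P ∈ ℝ²`, and the grid.

References: G. Benfatto, A. Giuliani, V. Mastropietro, Ann. Henri Poincaré 7 (2006) 809–898 = arXiv:cond-mat/0507686, (2.96),
App. A3 Lemma A3.1, Lemma 3.1; J. Feldman, H. Knörrer, E. Trubowitz, Commun. Math. Phys. 247 (2004) 1–47, §I.8 («‖v̂‖_{1,Σ} =
O(1/𝔩)»); HOME/prover-p4/COUNTING-NOTE.md; HOME/p1/E5A-NOTE.md §2 (numerics: kit j249692).
-/

noncomputable section

namespace Summit.HubbardSuperconductivity.HubbardSuperconductivity.Theorems.CountPairsAniso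

set_option linter.dupNamespace false -- summit = problem name (single-conjunct summit), D-0017

open Real Set
open Literature.MathematicalPhysics.QuantumLattice Literature.MathematicalPhysics.QuantumLattice.BandSectorCounting
open Summit.HubbardSuperconductivity.HubbardSuperconductivity.Theorems.CountPairsOffset

/-! ### Two elementary estimates -/

/-- **The dyadic depth against the mesh**: if `2^J w = π` and `0 < w ≤ 1` then `(J + 1)√w ≤ 7`
(`J log 2 = log(π/w) ≤ 2√(π/w)`, `√π < 2`, `log 2 > 0.69`). [folklore] -/
theorem dyadic_level_mul_sqrt_le {w : ℝ} {J : ℕ} (hw : 0 < w) (hw1 : w ≤ 1) (hJ : (2 : ℝ) ^ J * w = π) :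
    ((J : ℝ) + 1) * Real.sqrt w ≤ 7 := by
  have hπ := Real.pi_pos
  have h2J : (2 : ℝ) ^ J = π / w := by rw [eq_div_iff hw.ne']; exact hJ
  have hlog : (J : ℝ) * Real.log 2 = Real.log (π / w) := by rw [← Real.log_pow, h2J]
  have hle : Real.log (π / w) ≤ 2 * Real.sqrt (π / w) := by
    have h := Real.log_le_rpow_div (x := π / w) (by positivity) (ε := 1 / 2) (by norm_num)
    rw [Real.sqrt_eq_rpow]
    have e : (π / w) ^ (1 / 2 : ℝ) / (1 / 2) = 2 * (π / w) ^ (1 / 2 : ℝ) := by ring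
    rw [e] at h; exact h
  have hsq : Real.sqrt (π / w) * Real.sqrt w = Real.sqrt π := by
    rw [← Real.sqrt_mul (by positivity), div_mul_cancel₀ _ hw.ne']
  have hsw : 0 ≤ Real.sqrt w := Real.sqrt_nonneg w
  have hJw : (J : ℝ) * Real.sqrt w * Real.log 2 ≤ 2 * Real.sqrt π := by
    have := mul_le_mul_of_nonneg_right (hlog.le.trans hle) hsw
    calc (J : ℝ) * Real.sqrt w * Real.log 2 = (J : ℝ) * Real.log 2 * Real.sqrt w := by ring
      _ ≤ 2 * Real.sqrt (π / w) * Real.sqrt w := this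
      _ = 2 * Real.sqrt π := by rw [mul_assoc, hsq]
  have hlog2 : (0.6931471803 : ℝ) < Real.log 2 := Real.log_two_gt_d9
  have hsqrtpi : Real.sqrt π < 2 := by
    rw [show (2 : ℝ) = Real.sqrt 4 by rw [show (4 : ℝ) = 2 ^ 2 by norm_num, Real.sqrt_sq (by norm_num : (0:ℝ) ≤ 2)]]
    exact Real.sqrt_lt_sqrt hπ.le Real.pi_lt_four
  have hw' : Real.sqrt w ≤ 1 := by rw [← Real.sqrt_one]; exact Real.sqrt_le_sqrt hw1
  have hJs : (J : ℝ) * Real.sqrt w ≤ 6 := by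
    by_contra hcon
    push Not at hcon
    have : 6 * 0.6931471803 < (J : ℝ) * Real.sqrt w * Real.log 2 := by
      calc (6 : ℝ) * 0.6931471803 < 6 * Real.log 2 := by linarith
        _ ≤ (J : ℝ) * Real.sqrt w * Real.log 2 := by nlinarith
    linarith
  nlinarith

set_option maxHeartbeats 800000 in
/-- **The forward-fold constant of `count_anti_totalP` scales like `√w` in the tolerance**: with the letters of that theorem
(`Q` = the stratification constant, `hm = h_min`, `A = A₂`), `K_dy(c·w) ≤ √w · K_dy(c)` for `0 < w ≤ 1` — every one of its five
terms carries the tolerance to a power `≥ ½`. [folklore] -/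
theorem forwardFold_const_scale {Q η₀ η₁ hm A c w : ℝ} (hQ : 0 ≤ Q) (hη₀ : 0 < η₀) (hη₁ : 0 < η₁) (hhm : 0 < hm)
    (hc : 0 < c) (hw : 0 < w) (hw1 : w ≤ 1) :
    2 * Real.sqrt (c * w / (hm / 2)) *
        (2 * (32 * Q / η₁ + 16 * π / η₀) * (c * w) + (8 * Q / Real.sqrt (2 * hm)) * Real.sqrt (2 * (c * w)) + 2 * Q) +
      (2 * (32 * Q / η₁ + 16 * π / η₀) * (2 * (c * w) * Real.sqrt (2 * (2 * A)) / (hm / 2)) * Real.sqrt (c * w * π) +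
        Real.sqrt 2 * (8 * Q / Real.sqrt (2 * hm)) * (2 * (c * w) * Real.sqrt (2 * (2 * A)) / (hm / 2)) +
        2 * Q * (2 * (c * w) * Real.sqrt (2 * (2 * A)) / (hm / 2)) / Real.sqrt (c * w)) +
      8 * π * (2 * (c * w) * Real.sqrt (2 * (2 * A)) / (hm / 2)) / Real.sqrt (2 * (c * w) * π)
    ≤ Real.sqrt w *
      (2 * Real.sqrt (c / (hm / 2)) *
          (2 * (32 * Q / η₁ + 16 * π / η₀) * c + (8 * Q / Real.sqrt (2 * hm)) * Real.sqrt (2 * c) + 2 * Q) +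
        (2 * (32 * Q / η₁ + 16 * π / η₀) * (2 * c * Real.sqrt (2 * (2 * A)) / (hm / 2)) * Real.sqrt (c * π) +
          Real.sqrt 2 * (8 * Q / Real.sqrt (2 * hm)) * (2 * c * Real.sqrt (2 * (2 * A)) / (hm / 2)) +
          2 * Q * (2 * c * Real.sqrt (2 * (2 * A)) / (hm / 2)) / Real.sqrt c) +
        8 * π * (2 * c * Real.sqrt (2 * (2 * A)) / (hm / 2)) / Real.sqrt (2 * c * π)) := by
  have hπ := Real.pi_pos
  set s := Real.sqrt w with hs
  have hs0 : 0 < s := Real.sqrt_pos.2 hw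
  have hs1 : s ≤ 1 := by rw [hs, ← Real.sqrt_one]; exact Real.sqrt_le_sqrt hw1
  have hws : w = s * s := by rw [hs, Real.mul_self_sqrt hw.le]
  -- the building blocks and their scaling
  set X := 32 * Q / η₁ + 16 * π / η₀ with hX
  set Y := 8 * Q / Real.sqrt (2 * hm) with hY
  set S := Real.sqrt (2 * (2 * A)) with hS
  have hX0 : 0 ≤ X := by positivity
  have hY0 : 0 ≤ Y := by positivity
  have hS0 : 0 ≤ S := Real.sqrt_nonneg _
  set r := Real.sqrt (c / (hm / 2)) with hr
  set R := 2 * c * S / (hm / 2) with hR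
  have hr0 : 0 ≤ r := Real.sqrt_nonneg _
  have hR0 : 0 ≤ R := by positivity
  have e1 : Real.sqrt (c * w / (hm / 2)) = r * s := by
    rw [hr, hs, ← Real.sqrt_mul (by positivity)]; congr 1; ring
  have e2 : Real.sqrt (2 * (c * w)) = Real.sqrt (2 * c) * s := by
    rw [hs, ← Real.sqrt_mul (by positivity)]; congr 1; ring
  have e3 : 2 * (c * w) * S / (hm / 2) = R * (s * s) := by rw [hR, hws]; ring
  have e4 : Real.sqrt (c * w * π) = Real.sqrt (c * π) * s := by
    rw [hs, ← Real.sqrt_mul (by positivity)]; congr 1; ring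
  have e5 : Real.sqrt (c * w) = Real.sqrt c * s := by rw [hs, ← Real.sqrt_mul hc.le]
  have e6 : Real.sqrt (2 * (c * w) * π) = Real.sqrt (2 * c * π) * s := by
    rw [hs, ← Real.sqrt_mul (by positivity)]; congr 1; ring
  have hc2 : 0 < Real.sqrt (2 * c) := Real.sqrt_pos.2 (by positivity)
  have hcs : 0 < Real.sqrt c := Real.sqrt_pos.2 hc
  have hcp : 0 < Real.sqrt (c * π) := Real.sqrt_pos.2 (by positivity)
  have hc2p : 0 < Real.sqrt (2 * c * π) := Real.sqrt_pos.2 (by positivity)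
  rw [e1, e2, e3, e4, e5, e6]
  -- term by term
  have t1 : 2 * (r * s) * (2 * X * (c * w) + Y * (Real.sqrt (2 * c) * s) + 2 * Q)
      ≤ s * (2 * r * (2 * X * c + Y * Real.sqrt (2 * c) + 2 * Q)) := by
    have i1 : 2 * X * (c * w) ≤ 2 * X * c := by
      have : c * w ≤ c := by nlinarith
      exact mul_le_mul_of_nonneg_left this (by positivity)
    have i2 : Y * (Real.sqrt (2 * c) * s) ≤ Y * Real.sqrt (2 * c) := by
      have : Real.sqrt (2 * c) * s ≤ Real.sqrt (2 * c) := by nlinarith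
      exact mul_le_mul_of_nonneg_left this hY0
    have : 2 * X * (c * w) + Y * (Real.sqrt (2 * c) * s) + 2 * Q ≤ 2 * X * c + Y * Real.sqrt (2 * c) + 2 * Q := by
      linarith
    calc 2 * (r * s) * (2 * X * (c * w) + Y * (Real.sqrt (2 * c) * s) + 2 * Q)
        = s * (2 * r) * (2 * X * (c * w) + Y * (Real.sqrt (2 * c) * s) + 2 * Q) := by ring
      _ ≤ s * (2 * r) * (2 * X * c + Y * Real.sqrt (2 * c) + 2 * Q) :=
          mul_le_mul_of_nonneg_left this (by positivity)
      _ = s * (2 * r * (2 * X * c + Y * Real.sqrt (2 * c) + 2 * Q)) := by ring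
  have hss : s * s ≤ 1 := mul_le_one₀ hs1 hs0.le hs1
  have hs2 : s * s ≤ s := by nlinarith
  have hs3 : s * s * s ≤ s := by
    calc s * s * s ≤ 1 * s := mul_le_mul_of_nonneg_right hss hs0.le
      _ = s := one_mul s
  have t2 : 2 * X * (R * (s * s)) * (Real.sqrt (c * π) * s) ≤ s * (2 * X * R * Real.sqrt (c * π)) := by
    have hM : 0 ≤ 2 * X * R * Real.sqrt (c * π) := by positivity
    calc 2 * X * (R * (s * s)) * (Real.sqrt (c * π) * s) = (s * s * s) * (2 * X * R * Real.sqrt (c * π)) := by ring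
      _ ≤ s * (2 * X * R * Real.sqrt (c * π)) := mul_le_mul_of_nonneg_right hs3 hM
  have t3 : Real.sqrt 2 * Y * (R * (s * s)) ≤ s * (Real.sqrt 2 * Y * R) := by
    have hM : 0 ≤ Real.sqrt 2 * Y * R := by positivity
    calc Real.sqrt 2 * Y * (R * (s * s)) = (s * s) * (Real.sqrt 2 * Y * R) := by ring
      _ ≤ s * (Real.sqrt 2 * Y * R) := mul_le_mul_of_nonneg_right hs2 hM
  have t4 : 2 * Q * (R * (s * s)) / (Real.sqrt c * s) = s * (2 * Q * R / Real.sqrt c) := by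
    field_simp
  have t5 : 8 * π * (R * (s * s)) / (Real.sqrt (2 * c * π) * s) = s * (8 * π * R / Real.sqrt (2 * c * π)) := by
    field_simp
  rw [t4, t5]
  linarith [t1, t2, t3]

/-! ### The count -/

section Assembly

variable {a b : ℝ} (B : BandBounds a b)
include B

set_option maxHeartbeats 1600000 in
/-- **Lemma F.1 at anisotropic tolerance — the pair count is `O(1/w)`, uniformly in the offset** [cite:
BenfattoGiulianiMastropietro2006, (2.96) and App. A3 Lemma A3.1 (L = 4)]: for constants chosen small in terms of the uniform
band bounds `B` (the same smallness conditions as `count_pairs_offset_exists`), there is `K_p > 0` such that on every grid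
`N w = 2π`, `2^J w = π`, `0 < w ≤ 1`, for every level `μ` with margin `η₀` and EVERY offset `P ∈ ℝ²`,
`#{(a, c) ∈ [0,N)² : |h_P(θ_a, θ_c)| ≤ C_δ·w·w} ≤ K_p / w` — no `J`, no `log N`.  (The pairs are those of grid points
`θ_i = w/2 + i w` for which some fourth momentum `P + p(θ_a) + p(θ_c)` lies in the energy shell of width `C_δ w²`, i.e. the
sector pairs compatible with an anisotropic cell; the level function is `2π`-periodic, so conservation is modulo `2πℤ²`.) -/
theorem count_pairs_aniso_exists {Cδ τ lam η₀ η₁ : ℝ} (hCδ : 0 < Cδ) (hτ : 0 < τ) (hτπ : τ < π) (hlam : 0 < lam)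
    (hη₀ : 0 < η₀) (hη₁ : 0 < η₁)
    (hcov : 2 * (B.Cg * (lam / 2 + 2 * B.smax * (η₀ / B.Dtmin))) ≤ τ)
    (hodd : 4 * B.A2 * (η₀ / B.Dtmin + B.smax * (B.Cg * (lam + 2 * B.smax * (η₀ / B.Dtmin)) + τ)) ≤ B.hmin)
    (heven : 2 * B.A2 * (η₀ / B.Dtmin + B.smax * (B.Cg * (lam + B.A2 * τ + 2 * B.smax * (η₀ / B.Dtmin)) + τ / 2)) ≤ B.hmin / 2)
    (hH : (16 * B.smax ^ 2 + 8 * B.A2) * (η₀ / B.Dtmin + B.smax * (B.Cg * (η₁ / 4 + 2 * B.smax * (η₀ / B.Dtmin)))) ≤ 2 * B.hmin) :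
    ∃ Kp : ℝ, 0 < Kp ∧ ∀ μ : ℝ, μ ∈ Icc a b → a ≤ μ - η₀ → μ + η₀ ≤ b →
      ∀ (P : ℝ × ℝ) (w : ℝ) (N Nh J : ℕ), 0 < w → w ≤ 1 → (N : ℝ) * w = 2 * π → (Nh : ℝ) * w = π → N = 2 * Nh →
        (2 : ℝ) ^ J * w = π → Cδ * w ≤ η₀ / 2 →
        ((((Finset.range N ×ˢ Finset.range N).filter fun p : ℕ × ℕ =>
            |hfunP μ P (w / 2 + p.1 * w) (w / 2 + p.2 * w)| ≤ Cδ * w * w).card : ℝ)) ≤ Kp / w := by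
  have hA := B.A2_pos; have hs := B.smax_pos; have hh := B.hmin_pos; have hCg := B.Cg_pos; have hDt := B.Dtmin_pos
  have hπ := Real.pi_pos
  -- the constants (all independent of `w`, `μ`, `P`)
  obtain ⟨Q₄, hQ₄⟩ : ∃ Q₄ : ℝ, Q₄ = 4 * π / min (η₀ / (2 * (8 * B.smax))) (η₁ / (4 * (16 * B.smax ^ 2 + 8 * B.A2))) + 1 := ⟨_, rfl⟩
  obtain ⟨Kdy, hKdy⟩ : ∃ Kdy : ℝ, Kdy = 2 * Real.sqrt (Cδ / (B.hmin / 2)) *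
          (2 * (32 * Q₄ / η₁ + 16 * π / η₀) * Cδ + (8 * Q₄ / Real.sqrt (2 * B.hmin)) * Real.sqrt (2 * Cδ) + 2 * Q₄) +
        (2 * (32 * Q₄ / η₁ + 16 * π / η₀) * (2 * Cδ * Real.sqrt (2 * (2 * B.A2)) / (B.hmin / 2)) * Real.sqrt (Cδ * π) +
          Real.sqrt 2 * (8 * Q₄ / Real.sqrt (2 * B.hmin)) * (2 * Cδ * Real.sqrt (2 * (2 * B.A2)) / (B.hmin / 2)) +
          2 * Q₄ * (2 * Cδ * Real.sqrt (2 * (2 * B.A2)) / (B.hmin / 2)) / Real.sqrt Cδ) +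
        8 * π * (2 * Cδ * Real.sqrt (2 * (2 * B.A2)) / (B.hmin / 2)) / Real.sqrt (2 * Cδ * π) := ⟨_, rfl⟩
  obtain ⟨F₅, hF₅⟩ : ∃ F₅ : ℝ, F₅ = τ / min (η₀ / (2 * (2 * B.A2) * τ)) (2 * lam / (8 * B.smax ^ 2 + 4 * B.A2)) + 1 := ⟨_, rfl⟩
  obtain ⟨C₅, hC₅⟩ : ∃ C₅ : ℝ, C₅ = 2 * π / min (η₀ / (2 * (4 * B.A2 * τ))) (lam / (8 * B.smax ^ 2 + 4 * B.A2)) + 1 := ⟨_, rfl⟩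
  obtain ⟨C₃', hC₃'⟩ : ∃ C₃' : ℝ, C₃' = (2 * π / (lam / (2 * (4 * B.smax ^ 2 + 4 * B.A2))) + 1) * (2 * (4 * Cδ / lam + 1)) := ⟨_, rfl⟩
  have hℓ₄ : 0 < min (η₀ / (2 * (8 * B.smax))) (η₁ / (4 * (16 * B.smax ^ 2 + 8 * B.A2))) := lt_min (by positivity) (by positivity)
  have hℓ₅ : 0 < min (η₀ / (2 * (2 * B.A2) * τ)) (2 * lam / (8 * B.smax ^ 2 + 4 * B.A2)) := lt_min (by positivity) (by positivity)
  have hℓO : 0 < min (η₀ / (2 * (4 * B.A2 * τ))) (lam / (8 * B.smax ^ 2 + 4 * B.A2)) := lt_min (by positivity) (by positivity)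
  have hQ₄0 : 0 < Q₄ := by rw [hQ₄]; positivity
  have hKdy0 : 0 ≤ Kdy := by rw [hKdy]; positivity
  have hF₅0 : 0 ≤ F₅ := by rw [hF₅]; positivity
  have hC₅0 : 0 ≤ C₅ := by rw [hC₅]; positivity
  have hC₃'0 : 0 ≤ C₃' := by rw [hC₃']; positivity
  refine ⟨4 * π * C₃' + (2 * π + 2 * (F₅ * (14 * Kdy + 16 * π))) + 2 * π * (1 + 2 * C₅ * (4 * Cδ / B.hmin + 1)),
    by positivity, fun μ hμ hlo hhi P w N Nh J hw hw1 hN hNh hNN hJ h2δ => ?_⟩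
  obtain ⟨h1, h2⟩ := B.level hμ
  -- the anisotropic tolerance `δ = Cδ w²` and its smallness
  have hδ0 : 0 ≤ Cδ * w * w := by positivity
  have hδpos : 0 < Cδ * w * w := by positivity
  have h2δ' : Cδ * w * w ≤ η₀ / 2 := by
    have : Cδ * w * w ≤ Cδ * w := by nlinarith
    exact this.trans h2δ
  have hδη : Cδ * w * w ≤ η₀ := by linarith only [h2δ', hη₀]
  have hN0 : (0 : ℝ) < N := by
    have : (0:ℝ) < N * w := by rw [hN]; positivity
    exact pos_of_mul_pos_left this hw.le
  have hNpos : 0 < N := Nat.pos_of_ne_zero (fun h0 => by rw [h0] at hN0; simp at hN0)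
  have hN1 : (1 : ℝ) ≤ N := by exact_mod_cast hNpos
  have hlog : 0 ≤ Real.log N := Real.log_nonneg hN1
  have hlogN : 1 + Real.log N ≤ N := by have := Real.log_le_sub_one_of_pos hN0; linarith
  have hNw : (N : ℝ) = 2 * π / w := by field_simp; linarith only [hN]
  -- the three families of pairs (p4's fibration, tolerance `Cδ w²`)
  set S := Finset.range N ×ˢ Finset.range N with hS
  set PP := S.filter (fun p : ℕ × ℕ => |hfunP μ P (w / 2 + p.1 * w) (w / 2 + p.2 * w)| ≤ Cδ * w * w) with hPP
  set P₃ := S.filter (fun p : ℕ × ℕ => |hfunP μ P (w / 2 + p.1 * w) (w / 2 + p.2 * w)| ≤ Cδ * w * w ∧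
    lam ≤ |h3P μ P (w / 2 + p.1 * w) (w / 2 + p.2 * w)|) with hP₃
  set P₂ := S.filter (fun p : ℕ × ℕ => |hfunP μ P (w / 2 + p.1 * w) (w / 2 + p.2 * w)| ≤ Cδ * w * w ∧
    lam ≤ |h3P μ P (w / 2 + p.2 * w) (w / 2 + p.1 * w)|) with hP₂
  set P₀ := S.filter (fun p : ℕ × ℕ => |hfunP μ P (w / 2 + p.1 * w) (w / 2 + p.2 * w)| ≤ Cδ * w * w ∧
    |h3P μ P (w / 2 + p.1 * w) (w / 2 + p.2 * w)| < lam ∧ |h3P μ P (w / 2 + p.2 * w) (w / 2 + p.1 * w)| < lam) with hP₀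
  have hsub : PP ⊆ P₃ ∪ (P₂ ∪ P₀) := by
    intro p hp
    rw [hPP, Finset.mem_filter] at hp
    rw [Finset.mem_union, Finset.mem_union, hP₃, hP₂, hP₀, Finset.mem_filter, Finset.mem_filter, Finset.mem_filter]
    by_cases h3a : lam ≤ |h3P μ P (w / 2 + p.1 * w) (w / 2 + p.2 * w)|
    · exact Or.inl ⟨hp.1, hp.2, h3a⟩
    · by_cases h3b : lam ≤ |h3P μ P (w / 2 + p.2 * w) (w / 2 + p.1 * w)|
      · exact Or.inr (Or.inl ⟨hp.1, hp.2, h3b⟩)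
      · exact Or.inr (Or.inr ⟨hp.1, hp.2, not_le.1 h3a, not_le.1 h3b⟩)
  have hcardP : (PP.card : ℝ) ≤ (P₃.card : ℝ) + (P₂.card : ℝ) + (P₀.card : ℝ) := by
    have e1 := Finset.card_le_card hsub
    have e2 := Finset.card_union_le P₃ (P₂ ∪ P₀)
    have e3 := Finset.card_union_le P₂ P₀
    have : PP.card ≤ P₃.card + P₂.card + P₀.card := by omega
    exact_mod_cast this
  -- the transversal families: `O(N)`
  have hC₃le : (2 * π / (lam / (2 * (4 * B.smax ^ 2 + 4 * B.A2))) + 1) * (2 * ((4 * (Cδ * w * w) / lam) / w + 1)) ≤ C₃' := by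
    rw [hC₃']
    have e : (4 * (Cδ * w * w) / lam) / w = 4 * Cδ / lam * w := by field_simp
    rw [e]
    have : 4 * Cδ / lam * w ≤ 4 * Cδ / lam := mul_le_of_le_one_right (by positivity) hw1
    gcongr
  have hP₃ : (P₃.card : ℝ) ≤ N * C₃' := by
    calc (P₃.card : ℝ) = ∑ i ∈ Finset.range N, ((((Finset.range N).filter fun c : ℕ =>
          |hfunP μ P (w / 2 + i * w) (w / 2 + c * w)| ≤ Cδ * w * w ∧ lam ≤ |h3P μ P (w / 2 + i * w) (w / 2 + c * w)|).card : ℝ)) :=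
          card_filter_prod_eq_sum N (fun i c : ℕ => |hfunP μ P (w / 2 + i * w) (w / 2 + c * w)| ≤ Cδ * w * w ∧
            lam ≤ |h3P μ P (w / 2 + i * w) (w / 2 + c * w)|)
      _ ≤ N * ((2 * π / (lam / (2 * (4 * B.smax ^ 2 + 4 * B.A2))) + 1) * (2 * ((4 * (Cδ * w * w) / lam) / w + 1))) :=
          count_transversalP B hμ hw hlam hδ0 hN
      _ ≤ N * C₃' := mul_le_mul_of_nonneg_left hC₃le hN0.le
  have hP₂ : (P₂.card : ℝ) ≤ N * C₃' := by
    calc (P₂.card : ℝ) = ∑ c ∈ Finset.range N, ((((Finset.range N).filter fun i : ℕ =>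
          |hfunP μ P (w / 2 + i * w) (w / 2 + c * w)| ≤ Cδ * w * w ∧ lam ≤ |h3P μ P (w / 2 + c * w) (w / 2 + i * w)|).card : ℝ)) :=
          card_filter_prod_eq_sum' N (fun i c : ℕ => |hfunP μ P (w / 2 + i * w) (w / 2 + c * w)| ≤ Cδ * w * w ∧
            lam ≤ |h3P μ P (w / 2 + c * w) (w / 2 + i * w)|)
      _ ≤ N * ((2 * π / (lam / (2 * (4 * B.smax ^ 2 + 4 * B.A2))) + 1) * (2 * ((4 * (Cδ * w * w) / lam) / w + 1))) :=
          count_transversalP' B hμ hw hlam hδ0 hN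
      _ ≤ N * C₃' := mul_le_mul_of_nonneg_left hC₃le hN0.le
  -- the family with both partials small: reindex by the shift, split the shifts in three ranges
  set f : ℕ → ℝ := fun k => ((((Finset.range N).filter fun i : ℕ =>
      |hfunP μ P (w / 2 + i * w) (w / 2 + i * w + k * w)| ≤ Cδ * w * w ∧
      |h3P μ P (w / 2 + i * w) (w / 2 + i * w + k * w)| < lam ∧
      |h3P μ P (w / 2 + i * w + k * w) (w / 2 + i * w)| < lam).card : ℝ)) with hf
  have hP₀ : (P₀.card : ℝ) ≤ ∑ k ∈ Finset.range N, f k := count_reindexP B hμ hN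
  have hf0 : ∀ k, 0 ≤ f k := fun k => by positivity
  have hsplit := sum_split_three (N := N) f (fun k : ℕ => (k : ℝ) * w ≤ τ) (fun k : ℕ => |(k : ℝ) * w - π| ≤ τ)
    (fun k : ℕ => 2 * π - τ ≤ (k : ℝ) * w) hf0 (by
      intro k hk hfk
      rw [Finset.mem_range] at hk
      have hne : ((Finset.range N).filter fun i : ℕ =>
          |hfunP μ P (w / 2 + i * w) (w / 2 + i * w + k * w)| ≤ Cδ * w * w ∧
          |h3P μ P (w / 2 + i * w) (w / 2 + i * w + k * w)| < lam ∧
          |h3P μ P (w / 2 + i * w + k * w) (w / 2 + i * w)| < lam).Nonempty := by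
        rw [← Finset.card_pos]
        by_contra h0
        push Not at h0
        have : f k = 0 := by rw [hf]; dsimp only; exact_mod_cast Nat.le_zero.1 h0
        exact hfk this
      obtain ⟨i, hi⟩ := hne
      rw [Finset.mem_filter] at hi
      exact krangeP B hμ hw hN hk hτπ hlo hhi hδη hcov hi.2)
  have hA' := count_even_posP (μ := μ) (P := P) (δ := Cδ * w * w) (lam := lam) (τ := τ) hw (N := N)
  have hC' := count_even_negP B hμ (P := P) (δ := Cδ * w * w) (lam := lam) (τ := τ) hw hN
  -- the Cooper range: the harmonic logarithm multiplies `w⁰`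
  have hBo : ∑ k ∈ (Finset.range N).filter (fun k : ℕ => |(k : ℝ) * w - π| ≤ τ), f k ≤
      N + 2 * C₅ * ((2 * (Cδ * w * w) / (B.hmin * w)) * (2 * (1 + Real.log N)) / w + N) := by
    have := count_odd_total_offset B hμ (P := P) (δ := Cδ * w * w) (lam := lam) (τ := τ) hw hN hNh hNN hδpos
      hη₀ hlam hτ h2δ' hlo hhi hodd
    rw [← hC₅] at this
    exact this
  have hodd' : ∑ k ∈ (Finset.range N).filter (fun k : ℕ => |(k : ℝ) * w - π| ≤ τ), f k ≤
      (1 + 2 * C₅ * (4 * Cδ / B.hmin + 1)) * N := by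
    refine hBo.trans ?_
    have e : (2 * (Cδ * w * w) / (B.hmin * w)) * (2 * (1 + Real.log N)) / w = 4 * Cδ / B.hmin * (1 + Real.log N) := by
      field_simp
      ring
    rw [e]
    have t : 4 * Cδ / B.hmin * (1 + Real.log N) ≤ 4 * Cδ / B.hmin * N := mul_le_mul_of_nonneg_left hlogN (by positivity)
    have : 2 * C₅ * (4 * Cδ / B.hmin * (1 + Real.log N) + N) ≤ 2 * C₅ * (4 * Cδ / B.hmin * N + N) :=
      mul_le_mul_of_nonneg_left (by linarith) (by positivity)
    calc (N : ℝ) + 2 * C₅ * (4 * Cδ / B.hmin * (1 + Real.log N) + N) ≤ N + 2 * C₅ * (4 * Cδ / B.hmin * N + N) := by linarith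
      _ = (1 + 2 * C₅ * (4 * Cδ / B.hmin + 1)) * N := by ring
  -- the forward (even) range: the fold constant at tolerance `Cδ w · w` gains `√w`, which absorbs the `J + 1`
  set EE := ∑ s ∈ Finset.range (4 * N), ((((Finset.range ⌊τ / w⌋₊).filter fun i : ℕ =>
      |hfunP μ P (w / 2 + s * (w / 2) - (w + i * w) / 2) (w / 2 + s * (w / 2) + (w + i * w) / 2)| ≤ Cδ * w * w ∧
      |GfunP μ P (w / 2 + s * (w / 2)) (w + i * w)| ≤ 2 * lam).card : ℝ)) with hEE
  have hE : EE ≤ F₅ * (2 * (((J : ℝ) + 1) * (Real.sqrt w * Kdy) / w + 4 * N)) := by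
    have h := count_anti_totalP B hμ (P := P) (Cδ := Cδ * w) hw hw1 hN hJ (by positivity) hlam hτ hη₀ hη₁ h2δ' hlo hhi heven hH
    rw [← hQ₄, ← hF₅] at h
    have hK := forwardFold_const_scale (Q := Q₄) (η₀ := η₀) (η₁ := η₁) (hm := B.hmin) (A := B.A2) (c := Cδ) (w := w)
      hQ₄0.le hη₀ hη₁ hh hCδ hw hw1
    rw [← hKdy] at hK
    refine h.trans ?_
    have hJ1 : 0 ≤ (J : ℝ) + 1 := by positivity
    have := mul_le_mul_of_nonneg_left hK hJ1
    have := div_le_div_of_nonneg_right this hw.le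
    nlinarith [hF₅0]
  have hE' : EE ≤ F₅ * (14 * Kdy + 16 * π) / w := by
    refine hE.trans ?_
    have hJw := dyadic_level_mul_sqrt_le hw hw1 hJ
    have t : ((J : ℝ) + 1) * (Real.sqrt w * Kdy) / w ≤ 7 * Kdy / w := by
      apply div_le_div_of_nonneg_right _ hw.le
      calc ((J : ℝ) + 1) * (Real.sqrt w * Kdy) = (((J : ℝ) + 1) * Real.sqrt w) * Kdy := by ring
        _ ≤ 7 * Kdy := mul_le_mul_of_nonneg_right hJw hKdy0
    have e : F₅ * (14 * Kdy + 16 * π) / w = F₅ * (2 * (7 * Kdy / w + 4 * (2 * π / w))) := by field_simp; ring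
    rw [e, ← hNw]
    exact mul_le_mul_of_nonneg_left (by linarith) hF₅0
  -- assemble
  have h0 : (P₀.card : ℝ) ≤ N + 2 * EE + (1 + 2 * C₅ * (4 * Cδ / B.hmin + 1)) * N := by
    have := hP₀.trans hsplit
    linarith only [this, hA', hC', hodd']
  have htot : (PP.card : ℝ) ≤ 2 * (N * C₃') + (N + 2 * (F₅ * (14 * Kdy + 16 * π) / w)) +
      (1 + 2 * C₅ * (4 * Cδ / B.hmin + 1)) * N := by
    linarith only [hcardP, hP₃, hP₂, h0, hE']
  refine htot.trans (le_of_eq ?_)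
  rw [hNw]
  field_simp
  ring

end Assembly

end Summit.HubbardSuperconductivity.HubbardSuperconductivity.Theorems.CountPairsAniso

end
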